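import Summits.PneNP.PneNP.Theorems.ConvexRankGatesLinAlgGateBlindDoorHost
import Summits.PneNP.PneNP.Theorems.ConvexRankGatesLinAlgGateBlindChainCoverOrder

/-!
# Route ConvexRankGates, crux `LinAlgGateBlind` (stmt-PneNP-10681): UNCONDITIONAL door for permutation-group gates of bounded group ORDER

Support theorem for the crux (line `dnf-invariant-wide-gates-see-small-cliques`; vocabulary of
`Theorems/ConvexRankGatesLinAlgGateBlindDefs.lean`): the door theorem `not_computes_clique_of_collapse`
(`…Theorems.ConvexRankGatesLinAlgGateBlindDoorHost`) applied to the group-ORDER form of the chain cover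
(`sgAt_permOrder_of_logb_le_rpow`, `…Theorems.ConvexRankGatesLinAlgGateBlindChainCoverOrder`) and the rewiring collapse
`isTermGate_permOrder_collapse`:

* `not_computes_clique_of_isOver_permOrder` — for every `c`, eventually in `m`, for every `M` with
  `log₂ M ≤ m^{11/16}/(8 log₂ m)`: no circuit over `{∧₂, ∨₂}` and membership gates `v ↦ [τ ∈ ⟨σ_i : v_i = 1⟩]` whose
  generators generate a group of order `≤ M` — on ANY number of points, nonabelian, unbounded fan-in — with `≤ m^c` gates
  computes `CLIQUE(m, ⌈m^{1/8}⌉)`.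

This contains the `PERM_d` door `not_computes_clique_of_isOver_perm` (`…PermCircuitLowerBound`, `|⟨σ⟩| ≤ d!`) and is the
most general unconditional statement the union-bound method yields for group gates: the obstruction to the crux's PERM half
is group ENTROPY `log₂ |⟨σ_i⟩| ≳ m^{11/16}` (at the crux's coupling `d = m^c`, `c ≥ 1`, e.g. `Sym(m)` itself), not the number
of points. No new definitions. [folklore]
-/

-- `Summit.PneNP.PneNP.…` duplicates `PneNP` BY DESIGN (single-problem summit).
set_option linter.dupNamespace false

noncomputable section

namespace Summit.PneNP.PneNP.Theorems

open Finset Filter Literature.Computability.Complexity Razborov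
open Summit.PneNP.PneNP.Cruxes.LinAlgGateBlind.DnfInvariantWideGatesSeeSmallCliques

/-- **Monotone circuits with bounded-order permutation-group gates are blind to `CLIQUE(m, ⌈m^{1/8}⌉)`
(unconditional).** For every `c`, eventually in `m`, for every `M` with `log₂ M ≤ m^{11/16}/(8 log₂ m)`: no circuit over
`{∧₂, ∨₂}` and membership gates `v ↦ [τ ∈ ⟨σ_i : v_i = 1⟩]` with `|⟨σ_i : i⟩| ≤ M` (any number of points), with `≤ m^c`
gates, computes `CLIQUE(m, ⌈m^{1/8}⌉)`. Door theorem + `isTermGate_permOrder_collapse` +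
`sgAt_permOrder_of_logb_le_rpow`. [folklore] -/
theorem not_computes_clique_of_isOver_permOrder : ∀ c : ℕ, ∀ᶠ m : ℕ in atTop, ∀ M : ℕ,
    Real.logb 2 M ≤ (m : ℝ) ^ (11 / 16 : ℝ) / (8 * Real.logb 2 m) →
    ∀ C : Circuit (KEdge m), C.IsOver ({GateFn.and 2, GateFn.or 2} ∪
      {g | ∃ (d : ℕ) (σ : Fin g.1 → Equiv.Perm (Fin d)) (τ : Equiv.Perm (Fin d)),
        Nat.card (Subgroup.closure (Set.range σ)) ≤ M ∧
          ∀ v, g.2 v = true ↔ τ ∈ Subgroup.closure (σ '' {i | v i = true})}) →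
      C.size ≤ m ^ c → ¬ C.Computes (cliqueFn m ⌈(m : ℝ) ^ (1 / 8 : ℝ)⌉₊) := by
  intro c
  filter_upwards [not_computes_clique_of_collapse c, sgAt_permOrder_of_logb_le_rpow c] with m hm hP M hM C hC hsize
  refine hm _ _ (fun g hg => ?_) (fun g hg A hA => ?_) (hP M hM) C hC hsize
  · obtain ⟨d, σ, τ, -, h⟩ := Set.mem_setOf_eq ▸ hg
    exact monotone_of_closure_gate g σ τ h
  · exact isTermGate_permOrder_collapse m (lOf m) M g A hA hg

end Summit.PneNP.PneNP.Theorems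

end
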